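import Summits.HodgeConjecture.CorCM.MumfordTateRankRibetTypeOneDerived
import Summits.HodgeConjecture.CorCM.MumfordTateRankTypeIVThreefoldData
import HarnessLib

/-!
# Per-factor data of a Ribet-type `(g − 1, 1)` abelian variety for the unitary Lemma (3.4)
# (derived Hodge Lie algebra SIMPLE of dimension `g² − 1`; skew centre `ℚφ^*`; multiplicities; the `Θ`-trace `tr(Θ_A φ^*_ℂ) = ±2(g − 2)i√d`)

COR-CM (cell `pub-hodgecm2`, seat `b27` gen 53, count-neutral Mumford–Tate-rank ladder; theorems only, no definition, no named fact; UNCONDITIONAL —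
nothing here uses or asserts HC_CM).  The every-dimension version of gen 52ʼs `CorCM/MumfordTateRankTypeIVThreefoldData`.  `A` is a complex abelian
variety of RIBET TYPE `(g − 1, 1)`: `g = dim A ≥ 3`, `φ : A → A` with `φ ∘ φ = −d` (`d > 0`), `dim_ℚ End⁰A = 2` (so `End⁰A = ℚ(√−d)`),
multiplicity ONE at `i√d` or at `−i√d` on `H^{1,0}(A)`, and `End⁰A` a field, not totally real (then `Lie Hg(H¹A) = 𝔲_K(H¹A, ψ)` has dimension
`g²` and `t(A) = g² + 1`, `CorCM/MumfordTateRankRibetTypeOne`; Ribet 1983 Thm. 3, Moonen–Zarhin (2.3) Type IV(1,1)).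
* §1 **`derived_facts_of_ribetTypeOne`** — `𝔡 = [Lie Hg(H¹A), Lie Hg(H¹A)]` is SIMPLE (every `𝔡`-stable subspace is `0` or `𝔡`), CENTRE-FREE and
  of dimension `g² − 1`: `Lie Hg = ℚφ^* ⊕ 𝔡` (Deligne, `CorCM/HodgeLieAlgebraReductive`), `dim Lie Hg = g²`, `dim W = n_μ + n_{μ̄} = g` for
  `W = ker(φ^*_ℂ − μ)`, and `UnitaryDerived.isSimple_of_finrank_eq` (`𝔡 ⊗ ℂ ≅ 𝔰𝔩_g(ℂ)`, simplicity of `𝔰𝔩_g`).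
* §2 **`ribetTypeOne_factor_data`** — the data of `H¹A` consumed by `CorCM/MumfordTateRankUnitaryPair{Splitting,Centre,Count}`: `φ^* ∈ End_Hdg`,
  `(φ^*)² = −d`, `End_Hdg = ℚ + ℚφ^*`, a root `μ` (`μ² = −d`) with multiplicity `1` on `H^{0,1}` and `≥ 2` on `H^{1,0}`, `φ^* ∈ Lie Hg`
  (`Θ`-rigidity is not needed for this: `𝔲_K ∋ φ`), the `ψ`-skew centre of `Lie Hg` inside `ℚφ^*`, and the `Θ`-trace `tr(Θ_A ∘ φ^*_ℂ) = i√d · k`,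
  `k = 2(n_{i√d} − n_{−i√d}) = ±2(g − 2) ≠ 0` (`HodgeTheory/RankOneCentreTimesCMCurveInvariance`).

## References
* [Ribet1983] K. A. Ribet, *Hodge classes on certain types of abelian varieties*, Amer. J. Math. 105 (1983), Thm. 3. [cite: Ribet1983, Thm. 3]
* [MoonenZarhin1999LowDim] B. Moonen, Yu. G. Zarhin, *Hodge classes on abelian varieties of low dimension*, Math. Ann. 315 (1999), §2 (2.3), §3 (3.1)
  [corpus: paper:arxiv-math_9901113 pp. 5–6]. [cite: MoonenZarhin1999LowDim, §2 (2.3)]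
* [Deligne1982HodgeCycles] P. Deligne, LNM 900 (1982), I §3 Prop. 3.4, Prop. 3.6. [cite: Deligne1982HodgeCycles, I §3 Prop. 3.6]
* [Gordon1997] B. B. Gordon, *A survey of the Hodge conjecture for abelian varieties*, 1.13.2 (`tr(Θφ) = 2i√d(n′ − n″)`), Thm. 6.3 (3).
  [cite: Gordon1997, 1.13.2]
* [Humphreys1972] J. E. Humphreys, GTM 9 (1972), §19.2 (`A_l` simple). [cite: Humphreys1972, §19.2]
-/

noncomputable section

open scoped TensorProduct
open CategoryTheory CategoryTheory.Limits Module NumberField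

namespace Summit.HodgeConjecture.CorCM

open Literature.AlgebraicGeometry.Motives
open Literature.AlgebraicGeometry.Motives.AbelianVariety
open Literature.AlgebraicGeometry.Motives.HodgeStructure
open Literature.AlgebraicGeometry.HodgeTheory
open Literature.AlgebraicGeometry.ComplexMultiplication

variable [HodgeTensorFacts.{0, 0}] {A : AbelianVariety ℂ} {n : ℕ}

/-! ## §1 The derived Hodge Lie algebra of a Ribet-type abelian variety is simple of dimension `g² − 1` -/

set_option maxHeartbeats 800000 in
/-- **For `A` of RIBET TYPE `(g − 1, 1)` (`g = dim A ≥ 3`, `φ ∘ φ = −d`, `dim_ℚ End⁰A = 2`, multiplicity one at `±i√d`, `End⁰A` a field, not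
totally real) the derived Hodge Lie algebra `𝔡 = [Lie Hg(H¹A), Lie Hg(H¹A)]` is SIMPLE (every `𝔡`-stable subspace is `0` or `𝔡`), CENTRE-FREE,
and of dimension `g² − 1`** — in the format consumed by `UnitaryPair.corners_le_and_finrank_le`.  `Lie Hg(H¹A) = ℚφ^* ⊕ 𝔡` has dimension `g²`
(`mtRank_hodge_one_of_ribetTypeOne'`, Deligne `CorCM/HodgeLieAlgebraReductive`), `dim W = n_μ + n_{μ̄} = g`, so `UnitaryDerived.isSimple_of_finrank_eq`
applies (`𝔡 ⊗ ℂ ≅ 𝔰𝔩_g(ℂ)`). [cite: Ribet1983, Thm. 3] [cite: MoonenZarhin1999LowDim, §2 (2.3)] [cite: Humphreys1972, §19.2]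
[cite: Deligne1982HodgeCycles, I §3 Prop. 3.6] -/
theorem derived_facts_of_ribetTypeOne (hA : IsSmoothProjective n A.X) (hF : IsField A.endAlgebra) (hnR : ¬ IsTotallyReal (EndField A hF))
    (φ : A ⟶ A) {d : ℕ} (hd : 0 < d) (hφ : φ ≫ φ = -(d • 𝟙 A)) (hE2 : Module.finrank ℚ A.endAlgebra = 2)
    (h1 : eigenMultiplicity A φ (Complex.I * (Real.sqrt d : ℂ)) = 1 ∨ eigenMultiplicity A φ (-(Complex.I * (Real.sqrt d : ℂ))) = 1)
    (hdim : 3 ≤ A.dim) :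
    haveI := BettiUniverse.finite hA 1
    (∀ 𝔡 I : Submodule ℚ (Module.End ℚ (bettiCohomology A.X 1)),
        𝔡 = Submodule.span ℚ {B | ∃ X' ∈ (BettiUniverse.hodge exists_isReal_hodgeModel_holds hA 1).hodgeLie,
          ∃ Y ∈ (BettiUniverse.hodge exists_isReal_hodgeModel_holds hA 1).hodgeLie, X' * Y - Y * X' = B} →
        I ≤ 𝔡 → (∀ X' ∈ 𝔡, ∀ Y ∈ I, X' * Y - Y * X' ∈ I) → I = ⊥ ∨ I = 𝔡) ∧
      (∀ 𝔡 : Submodule ℚ (Module.End ℚ (bettiCohomology A.X 1)),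
        𝔡 = Submodule.span ℚ {B | ∃ X' ∈ (BettiUniverse.hodge exists_isReal_hodgeModel_holds hA 1).hodgeLie,
          ∃ Y ∈ (BettiUniverse.hodge exists_isReal_hodgeModel_holds hA 1).hodgeLie, X' * Y - Y * X' = B} →
        ∀ d' ∈ 𝔡, (∀ X' ∈ 𝔡, X' * d' = d' * X') → d' = 0) ∧
      Module.finrank ℚ ↥(Submodule.span ℚ {B | ∃ X' ∈ (BettiUniverse.hodge exists_isReal_hodgeModel_holds hA 1).hodgeLie,
          ∃ Y ∈ (BettiUniverse.hodge exists_isReal_hodgeModel_holds hA 1).hodgeLie, X' * Y - Y * X' = B}) = A.dim * A.dim - 1 := by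
  classical
  have hnA : A.dim = n := schemeDim_eq_holds hA
  subst hnA
  haveI := BettiUniverse.finite hA 1
  letI : LieRing (Module.End ℚ (bettiCohomology A.X 1)) := LieRing.ofAssociativeRing
  set H := BettiUniverse.hodge exists_isReal_hodgeModel_holds hA 1 with hHdef
  set 𝔡₀ : Submodule ℚ (Module.End ℚ (bettiCohomology A.X 1)) :=
    Submodule.span ℚ {B | ∃ X' ∈ H.hodgeLie, ∃ Y ∈ H.hodgeLie, X' * Y - Y * X' = B} with h𝔡₀
  have h𝔡𝔥 : 𝔡₀ ≤ H.hodgeLie := Submodule.span_le.2 (by rintro _ ⟨X', hX, Y, hY, rfl⟩; exact H.commutator_mem_hodgeLie hX hY)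
  let 𝔏 : LieSubalgebra ℚ (Module.End ℚ (bettiCohomology A.X 1)) :=
    { 𝔡₀ with
      lie_mem' := fun {X' Y} hX hY => by rw [Ring.lie_def]; exact Submodule.subset_span ⟨X', h𝔡𝔥 hX, Y, h𝔡𝔥 hY, rfl⟩ }
  have h𝔏 : 𝔏.toSubmodule = 𝔡₀ := rfl
  have h0 : 0 < A.dim := by omega
  obtain ⟨ψ⟩ := BettiUniverse.hodge_isPolarizable exists_isReal_hodgeModel_holds hA 1
  have heff := BettiUniverse.hodge_isEffective exists_isReal_hodgeModel_holds hA 1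
  obtain ⟨hφE, hφ2, hZ⟩ := quadraticEnd_skewCentre_data exists_isReal_hodgeModel_holds hodgePQ_independent_of_hodgeModel_holds h0 hE2 hd hφ ψ
  have hφ𝔥 := bettiMap_mem_hodgeLie_of_ribetTypeOne hA φ hd hφ hE2 h1 hdim
  have hE := exists_eq_smul_one_add_smul_bettiMapHom exists_isReal_hodgeModel_holds hodgePQ_independent_of_hodgeModel_holds hd hφ hE2 h0
  set φQ : Module.End ℚ (bettiCohomology A.X 1) := (bettiCohomology.map φ.hom.hom.hom 1).hom with hφQ
  haveI : Nontrivial (bettiCohomology A.X 1) := Module.nontrivial_of_finrank_pos (R := ℚ) (by rw [finrank_bettiCohomology_one A]; omega)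
  have hφ0 : φQ ≠ 0 := fun h => by
    have h' := hφ2
    rw [h, mul_zero, eq_comm, neg_eq_zero, smul_eq_zero] at h'
    rcases h' with h' | h'
    · exact hd.ne' (by exact_mod_cast h')
    · exact one_ne_zero h'
  -- `dim 𝔡₀ = g² − 1`: `Lie Hg = ℚφ^* ⊕ 𝔡₀`, `dim Lie Hg = g²`
  have hcen : H.hodgeLie ⊓ Subalgebra.toSubmodule H.endAlg = ℚ ∙ φQ := by
    apply le_antisymm
    · intro z hz
      obtain ⟨hz𝔥, hzE⟩ := Submodule.mem_inf.1 hz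
      obtain ⟨c, rfl⟩ := hZ z hzE (fun b hb => commute_of_mem_hodgeLie H hz𝔥 ⟨b, hb⟩) (form_apply_add_eq_zero_of_mem_hodgeLie ψ hz𝔥)
      exact Submodule.mem_span_singleton.2 ⟨c, rfl⟩
    · rw [Submodule.span_singleton_le_iff_mem]
      exact Submodule.mem_inf.2 ⟨hφ𝔥, hφE⟩
  have hg2 := (mtRank_hodge_one_of_ribetTypeOne' hA hF hnR φ hd hφ hE2 h1 hdim).2
  have hdec := finrank_hodgeLie_hodge_one_eq_center_add_derived hA
  rw [hg2, hcen, finrank_span_singleton hφ0] at hdec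
  have hd𝔡 : Module.finrank ℚ ↥𝔡₀ = A.dim * A.dim - 1 := by
    have e : Module.finrank ℚ ↥𝔡₀ = Module.finrank ℚ ↥(Submodule.span ℚ {B | ∃ X' ∈ (BettiUniverse.hodge exists_isReal_hodgeModel_holds hA 1).hodgeLie,
        ∃ Y ∈ (BettiUniverse.hodge exists_isReal_hodgeModel_holds hA 1).hodgeLie, X' * Y - Y * X' = B}) := rfl
    omega
  -- the root `μ` with one line of type `(0,1)` and `dim W = g`
  have hμ₀ : (Complex.I * (Real.sqrt d : ℂ)) ^ 2 = -((d : ℚ) : ℂ) := by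
    rw [mul_pow, Complex.I_sq, ← Complex.ofReal_pow, Real.sq_sqrt (Nat.cast_nonneg d), Complex.ofReal_natCast, Rat.cast_natCast, neg_one_mul]
  have hconj₀ : starRingEnd ℂ (Complex.I * (Real.sqrt d : ℂ)) = -(Complex.I * (Real.sqrt d : ℂ)) := by
    rw [map_mul, Complex.conj_I, Complex.conj_ofReal, neg_mul]
  have hsum := eigenMultiplicity_add_eigenMultiplicity_neg_eq_dim A φ hd hφ
  obtain ⟨μ, hμ, hmW⟩ : ∃ μ : ℂ, μ ^ 2 = -((d : ℚ) : ℂ) ∧ eigenMultiplicity A φ μ + eigenMultiplicity A φ (starRingEnd ℂ μ) = A.dim :=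
    ⟨Complex.I * (Real.sqrt d : ℂ), hμ₀, by rw [hconj₀]; exact hsum⟩
  have hW : Module.finrank ℂ ↥(Module.End.eigenspace (φQ.baseChange ℂ) μ) = A.dim := by
    rw [UnitaryDerived.finrank_eigenspace_eq_add H (by norm_num) heff hφE μ, hφQ,
      finrank_eigenspace_inf_piece_oneZero_eq_eigenMultiplicity exists_isReal_hodgeModel_holds hodgePQ_independent_of_hodgeModel_holds φ μ,
      finrank_eigenspace_inf_piece_zeroOne_eq_eigenMultiplicity_conj exists_isReal_hodgeModel_holds hodgePQ_independent_of_hodgeModel_holds φ μ, hmW]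
  -- simplicity
  haveI : LieAlgebra.IsSimple ℚ 𝔏 :=
    UnitaryDerived.isSimple_of_finrank_eq H ψ hφE (Nat.cast_pos.2 hd) hφ2 hE hμ (by rw [hW]; omega)
      (by
        rw [hW, sq]
        have e : Module.finrank ℚ ↥(Submodule.span ℚ {B | ∃ X' ∈ H.hodgeLie, ∃ Y ∈ H.hodgeLie, X' * Y - Y * X' = B}) = Module.finrank ℚ ↥𝔡₀ := rfl
        rw [e, hd𝔡]
        have h9 : 1 ≤ A.dim * A.dim := Nat.one_le_iff_ne_zero.2 (Nat.mul_ne_zero (by omega) (by omega))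
        omega)
      𝔏 h𝔏
  refine ⟨fun 𝔡 I h𝔡 hI hstab => ?_, fun 𝔡 h𝔡 d' hd' hcomm => ?_, hd𝔡⟩
  · subst h𝔡
    let J : LieIdeal ℚ 𝔏 :=
      { (I.comap 𝔏.toSubmodule.subtype) with
        lie_mem := fun {x m} hm => by
          change ((⁅x, m⁆ : 𝔏) : Module.End ℚ (bettiCohomology A.X 1)) ∈ I
          rw [LieSubalgebra.coe_bracket, Ring.lie_def]
          exact hstab _ x.2 _ hm }
    rcases LieAlgebra.IsSimple.eq_bot_or_eq_top J with hJ | hJ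
    · left
      refine (Submodule.eq_bot_iff _).2 fun y hy => ?_
      have hy' : (⟨y, hI hy⟩ : 𝔏) ∈ J := hy
      rw [hJ] at hy'
      exact congrArg Subtype.val ((LieSubmodule.mem_bot _).1 hy')
    · right
      refine le_antisymm hI fun e he => ?_
      have he' : (⟨e, he⟩ : 𝔏) ∈ J := by rw [hJ]; exact LieSubmodule.mem_top _
      exact he'
  · subst h𝔡
    have hmem : (⟨d', hd'⟩ : 𝔏) ∈ LieAlgebra.center ℚ 𝔏 := by
      rw [LieModule.mem_maxTrivSubmodule]
      intro x
      apply Subtype.ext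
      rw [LieSubalgebra.coe_bracket, Ring.lie_def, hcomm _ x.2, sub_self]
      rfl
    have hcz : LieAlgebra.center ℚ 𝔏 = ⊥ :=
      le_bot_iff.1 ((LieAlgebra.center_le_radical ℚ 𝔏).trans (LieAlgebra.radical_eq_bot (R := ℚ) (L := 𝔏)).le)
    rw [hcz, LieSubmodule.mem_bot] at hmem
    exact congrArg Subtype.val hmem


/-! ## §2 Per-factor data -/

/-- **Per-factor data of a Ribet-type `(g − 1, 1)` abelian variety** in the shape consumed by `UnitaryPair.corners_le_and_finrank_le`,
`UnitaryPair.incl_phi_proj_mem_hodgeLie_of_nonresonant` and `UnitaryPair.finrank_add_finrank_add_two_le_of_corners` (module docstring §2):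
`φ^* ∈ End_Hdg`, `(φ^*)² = −d`, `End_Hdg = ℚ + ℚφ^*` (Riemann), a root `μ` of `−d` of multiplicity `1` on `H^{0,1}` and `≥ 2` on `H^{1,0}`,
`φ^* ∈ Lie Hg` (`Lie Hg = 𝔲_K ∋ φ^*`), the `ψ`-skew centre inside `ℚφ^*`, and `tr(Θ_A ∘ φ^*_ℂ) = i√d · k` with `k = 2(n_{i√d} − n_{−i√d}) ≠ 0`
(`n_{i√d} + n_{−i√d} = g ≥ 3` and one of them is `1`). [cite: MoonenZarhin1999LowDim, §2 (2.3)] [cite: Ribet1983, Thm. 3] [cite: Gordon1997, 1.13.2] -/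
theorem ribetTypeOne_factor_data (hA : IsSmoothProjective n A.X) (φ : A ⟶ A) {d : ℕ} (hd : 0 < d) (hφ : φ ≫ φ = -(d • 𝟙 A))
    (hE2 : Module.finrank ℚ A.endAlgebra = 2)
    (h1 : eigenMultiplicity A φ (Complex.I * (Real.sqrt d : ℂ)) = 1 ∨ eigenMultiplicity A φ (-(Complex.I * (Real.sqrt d : ℂ))) = 1)
    (hdim : 3 ≤ A.dim) :
    haveI := BettiUniverse.finite hA 1
    ∃ (μ : ℂ) (k : ℤ),
      (bettiCohomology.map φ.hom.hom.hom 1).hom ∈ (BettiUniverse.hodge exists_isReal_hodgeModel_holds hA 1).endAlg ∧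
      (bettiCohomology.map φ.hom.hom.hom 1).hom * (bettiCohomology.map φ.hom.hom.hom 1).hom = -((d : ℚ) • 1) ∧
      (∀ a ∈ (BettiUniverse.hodge exists_isReal_hodgeModel_holds hA 1).endAlg, ∃ x y : ℚ, a = x • 1 + y • (bettiCohomology.map φ.hom.hom.hom 1).hom) ∧
      μ ^ 2 = -((d : ℚ) : ℂ) ∧
      Module.finrank ℂ ↥(Module.End.eigenspace ((bettiCohomology.map φ.hom.hom.hom 1).hom.baseChange ℂ) μ ⊓
        (BettiUniverse.hodge exists_isReal_hodgeModel_holds hA 1).piece 0 1) = 1 ∧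
      2 ≤ Module.finrank ℂ ↥(Module.End.eigenspace ((bettiCohomology.map φ.hom.hom.hom 1).hom.baseChange ℂ) μ ⊓
        (BettiUniverse.hodge exists_isReal_hodgeModel_holds hA 1).piece 1 0) ∧
      (bettiCohomology.map φ.hom.hom.hom 1).hom ∈ (BettiUniverse.hodge exists_isReal_hodgeModel_holds hA 1).hodgeLie ∧
      (∀ (ψ : (BettiUniverse.hodge exists_isReal_hodgeModel_holds hA 1).Polarization),
        ∀ z ∈ (BettiUniverse.hodge exists_isReal_hodgeModel_holds hA 1).hodgeLie ⊓
          Subalgebra.toSubmodule (BettiUniverse.hodge exists_isReal_hodgeModel_holds hA 1).endAlg,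
          ∃ c : ℚ, z = c • (bettiCohomology.map φ.hom.hom.hom 1).hom) ∧
      (Complex.I * (Real.sqrt d : ℂ)) ^ 2 = -((d : ℚ) : ℂ) ∧ k ≠ 0 ∧
      (∀ Θ : Module.End ℂ (ℂ ⊗[ℚ] bettiCohomology A.X 1),
        (∀ p, ∀ x ∈ (BettiUniverse.hodge exists_isReal_hodgeModel_holds hA 1).piece p (((1 : ℕ) : ℤ) - p),
          Θ x = ((2 * p - ((1 : ℕ) : ℤ) : ℤ) : ℂ) • x) →
        LinearMap.trace ℂ _ (Θ * ((bettiCohomology.map φ.hom.hom.hom 1).hom).baseChange ℂ) = (Complex.I * (Real.sqrt d : ℂ)) * k) := by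
  classical
  have hnA : A.dim = n := schemeDim_eq_holds hA
  subst hnA
  haveI := BettiUniverse.finite hA 1
  have h0 : 0 < A.dim := by omega
  have hsum := eigenMultiplicity_add_eigenMultiplicity_neg_eq_dim A φ hd hφ
  obtain ⟨ψ₀⟩ := BettiUniverse.hodge_isPolarizable exists_isReal_hodgeModel_holds hA 1
  obtain ⟨hφE, hφ2, -⟩ := quadraticEnd_skewCentre_data exists_isReal_hodgeModel_holds hodgePQ_independent_of_hodgeModel_holds h0 hE2 hd hφ ψ₀
  have hE := exists_eq_smul_one_add_smul_bettiMapHom exists_isReal_hodgeModel_holds hodgePQ_independent_of_hodgeModel_holds hd hφ hE2 h0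
  have hμ₀ : (Complex.I * (Real.sqrt d : ℂ)) ^ 2 = -((d : ℚ) : ℂ) := by
    rw [mul_pow, Complex.I_sq, ← Complex.ofReal_pow, Real.sq_sqrt (Nat.cast_nonneg d), Complex.ofReal_natCast, Rat.cast_natCast, neg_one_mul]
  have hconj₀ : starRingEnd ℂ (Complex.I * (Real.sqrt d : ℂ)) = -(Complex.I * (Real.sqrt d : ℂ)) := by
    rw [map_mul, Complex.conj_I, Complex.conj_ofReal, neg_mul]
  obtain ⟨μ, hμ, hm1, hm2⟩ : ∃ μ : ℂ, μ ^ 2 = -((d : ℚ) : ℂ) ∧ eigenMultiplicity A φ (starRingEnd ℂ μ) = 1 ∧ 2 ≤ eigenMultiplicity A φ μ := by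
    rcases h1 with h | h
    · exact ⟨-(Complex.I * (Real.sqrt d : ℂ)), by rw [neg_sq, hμ₀], by rw [map_neg, hconj₀, neg_neg, h], by omega⟩
    · exact ⟨Complex.I * (Real.sqrt d : ℂ), hμ₀, by rw [hconj₀, h], by omega⟩
  have hk : (2 * ((eigenMultiplicity A φ (Complex.I * (Real.sqrt d : ℂ)) : ℤ) - eigenMultiplicity A φ (-(Complex.I * (Real.sqrt d : ℂ)))) : ℤ) ≠ 0 := by
    rcases h1 with h | h <;> omega
  refine ⟨μ, 2 * ((eigenMultiplicity A φ (Complex.I * (Real.sqrt d : ℂ)) : ℤ) - eigenMultiplicity A φ (-(Complex.I * (Real.sqrt d : ℂ)))),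
    hφE, hφ2, hE, hμ, ?_, ?_, bettiMap_mem_hodgeLie_of_ribetTypeOne hA φ hd hφ hE2 h1 hdim, fun ψ z hz => ?_, hμ₀, hk, fun Θ hΘ => ?_⟩
  · rw [finrank_eigenspace_inf_piece_zeroOne_eq_eigenMultiplicity_conj exists_isReal_hodgeModel_holds hodgePQ_independent_of_hodgeModel_holds φ μ, hm1]
  · rw [finrank_eigenspace_inf_piece_oneZero_eq_eigenMultiplicity exists_isReal_hodgeModel_holds hodgePQ_independent_of_hodgeModel_holds φ μ]
    exact hm2
  · obtain ⟨-, -, hZ⟩ := quadraticEnd_skewCentre_data exists_isReal_hodgeModel_holds hodgePQ_independent_of_hodgeModel_holds h0 hE2 hd hφ ψ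
    obtain ⟨hz𝔥, hzE⟩ := Submodule.mem_inf.1 hz
    exact hZ z hzE (fun b hb => commute_of_mem_hodgeLie _ hz𝔥 ⟨b, hb⟩) (form_apply_add_eq_zero_of_mem_hodgeLie ψ hz𝔥)
  · rw [trace_theta_mul_baseChange_pullback_eq exists_isReal_hodgeModel_holds hodgePQ_independent_of_hodgeModel_holds φ hd hφ hΘ]
    push_cast
    ring

end Summit.HodgeConjecture.CorCM

end
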